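import Summits.Parity.GeneralizedHardyLittlewood.Theorems.LeeYangFibresAbsoluteUpgradeTarget
import Summits.Parity.GeneralizedHardyLittlewood.Theorems.LeeYangFibresAssemblyClose
import Summits.Parity.GeneralizedHardyLittlewood.Theses.VarianceWitness
import HarnessLib

/-!
# Route `LeeYangFibres`, crux `AbsoluteUpgrade` (stmt-Parity-14116): the crux against the Statement

`AbsoluteUpgrade := RelativeDimOne → DimOne`.  The file `LeeYangFibresAbsoluteUpgradeTarget` (p121721)
placed the crux against the shared target `DicksonFibration.DimOne` (stmt-Parity-0819):
`AbsoluteUpgrade ↔ (DicksonFibration.DimOne ∨ ¬ RelativeDimOne)`.  Since then the shared routine support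
`FibrationLemma : DimOne → GeneralizedHardyLittlewood` (stmt-Parity-0822) has been PROVED in the tree
(`leeYangFibres_fibrationLemma`, Theses-free core `FibrationGlue.generalizedHardyLittlewood_of_dimOne`),
and `GeneralizedHardyLittlewood → DimOne` is the `d = 1` specialisation.  Hence the crux can now be read
against the sub-problem STATEMENT itself, with no hypothesis:

* `summit_iff_dimOne` : `GeneralizedHardyLittlewood ↔ DimOne`;
* `absoluteUpgrade_iff_summit_or` : `AbsoluteUpgrade ↔ (GeneralizedHardyLittlewood ∨ ¬ RelativeDimOne)`;
* `relativeDimOne_and_absoluteUpgrade_iff_summit` : the two hypotheses of the route's deciding theorem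
  `closes hR hU hF` that are still open are JOINTLY EQUIVALENT to the Statement they decide — the
  route is complete (its hypotheses are necessary) and its residual crux is the Statement on the
  `RelativeDimOne` branch;
* `not_absoluteUpgrade_iff_summit` : a refutation of the crux is a proof of `RelativeDimOne` together
  with a refutation of Green–Tao's Conjecture 1.2;
* `closesHypotheses_iff_summit` : `(RelativeDimOne ∧ AbsoluteUpgrade ∧ FibrationLemma) ↔ GeneralizedHardyLittlewood`;
* `varianceWitness_absoluteUpgrade_iff` : the second wanting route's copy
  `VarianceWitness.AbsoluteUpgrade` (route-Parity-VarianceWitness, 2026-08-17) is this crux verbatim, so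
  every normal form and the discharge `absoluteUpgrade_of_target` serve both routes.

Pure logic over landed theorems; nothing is asserted about primes.

References: Green–Tao 2010, Conj. 1.2 and the fibration remark following it [GreenTao2010].
-/

namespace Summit.Parity.GeneralizedHardyLittlewood.Theorems.AbsoluteUpgrade

open Summit.Parity.GeneralizedHardyLittlewood.Theses.LeeYangFibres
open Summit.Parity.GeneralizedHardyLittlewood.Theorems.LeeYangFibresRelativeDimOne (relativeDimOne_of_dimOne)

/-- `GeneralizedHardyLittlewood → DimOne`: Green–Tao's Conjecture 1.2 specialised to `d = 1`
(`N ^ 1 = N`). [cite: GreenTao2010, Conj. 1.2] -/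
theorem dimOne_of_summit (hG : _root_.GeneralizedHardyLittlewood) : DimOne := by
  intro t L ht ε hε
  obtain ⟨N₀, hN₀⟩ := hG 1 t L le_rfl ht ε hε
  refine ⟨N₀, fun N hN Ψ hΨ hL K hK hKN => ?_⟩
  simpa only [pow_one] using hN₀ N hN Ψ hΨ hL K hK hKN

/-- **`GeneralizedHardyLittlewood ↔ DimOne`** for this route's copy of the one-dimensional conjecture,
by the PROVED fibration lemma `leeYangFibres_fibrationLemma` (stmt-Parity-0822).
[cite: GreenTao2010, Conj. 1.2 and the remark following it] -/
theorem summit_iff_dimOne : _root_.GeneralizedHardyLittlewood ↔ DimOne :=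
  ⟨dimOne_of_summit, fun h => leeYangFibres_fibrationLemma h⟩

/-- The Statement discharges the crux (through `DimOne`). [folklore] -/
theorem absoluteUpgrade_of_summit (hG : _root_.GeneralizedHardyLittlewood) : AbsoluteUpgrade :=
  fun _ => dimOne_of_summit hG

/-- **Logical position of the crux against the Statement.** `AbsoluteUpgrade` holds iff Green–Tao's
Conjecture 1.2 holds or the route's output node `RelativeDimOne` fails. [folklore] -/
theorem absoluteUpgrade_iff_summit_or :
    AbsoluteUpgrade ↔ (_root_.GeneralizedHardyLittlewood ∨ ¬ RelativeDimOne) := by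
  rw [summit_iff_dimOne]
  exact absoluteUpgrade_iff_target_or

/-- **The open hypotheses of `closes` are the Statement.** With `FibrationLemma` proved, the two
remaining hypotheses `RelativeDimOne`, `AbsoluteUpgrade` of the route's deciding theorem are jointly
equivalent to `GeneralizedHardyLittlewood`. [folklore] -/
theorem relativeDimOne_and_absoluteUpgrade_iff_summit :
    (RelativeDimOne ∧ AbsoluteUpgrade) ↔ _root_.GeneralizedHardyLittlewood := by
  rw [summit_iff_dimOne]
  exact ⟨fun h => h.2 h.1, fun h => ⟨relativeDimOne_of_dimOne h, fun _ => h⟩⟩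

/-- All three hypotheses of `closes hR hU hF` together are equivalent to its conclusion: the route's
frame loses nothing (`→` is `closes`, `←` is necessity of each hypothesis). [folklore] -/
theorem closesHypotheses_iff_summit :
    (RelativeDimOne ∧ AbsoluteUpgrade ∧ FibrationLemma) ↔ _root_.GeneralizedHardyLittlewood :=
  ⟨fun h => h.2.2 (h.2.1 h.1),
    fun h => ⟨relativeDimOne_of_dimOne (dimOne_of_summit h), absoluteUpgrade_of_summit h,
      leeYangFibres_fibrationLemma⟩⟩

/-- **What a refutation would be.** `¬ AbsoluteUpgrade ↔ (RelativeDimOne ∧ ¬ GeneralizedHardyLittlewood)`: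
a disproof of the crux is a proof of uniform relative Hardy–Littlewood at `d = 1` (twin primes included)
together with a refutation of Green–Tao's Conjecture 1.2. [folklore] -/
theorem not_absoluteUpgrade_iff_summit :
    ¬ AbsoluteUpgrade ↔ (RelativeDimOne ∧ ¬ _root_.GeneralizedHardyLittlewood) := by
  rw [absoluteUpgrade_iff_summit_or, not_or, not_not, and_comm]

/-! ### The second wanting route: `VarianceWitness.AbsoluteUpgrade` is this crux verbatim -/

/-- Route `VarianceWitness` (opened 2026-08-17) files `RelativeDimOne`, `DimOne` and
`AbsoluteUpgrade := RelativeDimOne → DimOne` as verbatim copies of this route's declarations, so its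
crux is this crux up to unfolding. [folklore] -/
theorem varianceWitness_absoluteUpgrade_iff :
    Theses.VarianceWitness.AbsoluteUpgrade ↔ AbsoluteUpgrade := Iff.rfl

/-- … hence the shared target discharges the `VarianceWitness` copy too, by the same one-liner.
[folklore] -/
theorem varianceWitness_absoluteUpgrade_of_target (h : Theses.DicksonFibration.DimOne) :
    Theses.VarianceWitness.AbsoluteUpgrade := fun _ => h

/-- … and its logical position is the same: `VarianceWitness.AbsoluteUpgrade ↔
(GeneralizedHardyLittlewood ∨ ¬ RelativeDimOne)`. [folklore] -/
theorem varianceWitness_absoluteUpgrade_iff_summit_or :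
    Theses.VarianceWitness.AbsoluteUpgrade ↔ (_root_.GeneralizedHardyLittlewood ∨ ¬ RelativeDimOne) :=
  varianceWitness_absoluteUpgrade_iff.trans absoluteUpgrade_iff_summit_or

end Summit.Parity.GeneralizedHardyLittlewood.Theorems.AbsoluteUpgrade
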